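import Mathlib.Analysis.SpecialFunctions.Complex.Log
import Mathlib.LinearAlgebra.LinearIndependent.Lemmas
import Literature.NumberTheory.Transcendental.BakerCoefficientForm
import HarnessLib

/-!
# Linear forms in `π` and logarithms of positive algebraic numbers (Murty–Saradha, Lemma 10)

Topic `Literature/NumberTheory/Transcendental`. Proofs only (no definitions, no named facts), on the
tree's PROVED Baker theorem (`baker_holds`, read through `baker_coeff_eq_zero`,
`BakerCoefficientForm.lean`).

M. Ram Murty and N. Saradha, *Euler–Lehmer constants and a conjecture of Erdős*, J. Number Theory
130 (2010) 2671–2682 [MurtySaradha2010], §2: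

* «**Lemma 9.** If `α₁, …, αₙ ∈ ℚ̄ ∖ {0}` and `β₁, …, βₙ ∈ ℚ̄`, then `β₁ log α₁ + ⋯ + βₙ log αₙ` is
  either zero or transcendental.» (Baker 1975, Theorems 2.1–2.2.)
* «**Lemma 10.** Let `α₁, …, αₙ` be positive algebraic numbers. If `c₀, c₁, …, cₙ` are algebraic
  numbers with `c₀ ≠ 0`, then `c₀π + Σ_{i=1}^{n} cᵢ log αᵢ` is a transcendental number and hence
  non-zero.» Printed proof: choose a maximal linearly independent subset `T = {log αᵢ : i ∈ S}` of
  the `log αⱼ`; multiply by `i` and rewrite the sum as `Λ = c₀πi + Σ_{j∈S} dⱼ log αⱼ` with algebraic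
  `dⱼ`; if `log(−1) = πi` and the `log αⱼ`, `j ∈ S`, were linearly dependent over `ℚ`, a relation
  `b₀πi = Σ bⱼ log αⱼ` would have a purely imaginary left side and a real right side, so `b₀ = 0`
  and then every `bⱼ = 0`; hence Baker's theorem applies.

Here: `baker_pi_coeff_eq_zero` is Lemma 10 in COEFFICIENT form — a relation
`β₀ + c₀·(πi) + Σᵢ cᵢ log αᵢ = 0` with algebraic `β₀, c₀, cᵢ ∈ ℂ` and positive real algebraic `αᵢ`
forces `β₀ = 0` AND `c₀ = 0` (no independence hypothesis on the `log αᵢ`: the maximal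
`ℚ`-independent sub-family is chosen inside the proof, `exists_linearIndepOn_extension`, and
extended by `πi ∉ span_ℚ` of the real logarithms, `linearIndependent_option`); then Lemma 10 as
printed, over `ℂ` (`transcendental_pi_mul_add_sum_log`) and over `ℝ`
(`transcendental_real_pi_mul_add_sum_log`), and the edge `c₀ = 0` = Lemma 9's first clause for
positive real `αᵢ` (`sum_log_eq_zero_of_isAlgebraic`, `eq_one_of_isAlgebraic_log`).

Cell pub-zeta5 (HONEST FRAMING: systematic search; no irrationality claim unless certified): a
printed lemma made a kernel theorem; nothing here concerns `ζ(5)`.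
-/

noncomputable section

open Complex

namespace Literature.NumberTheory.Transcendental

/-- The `ℚ`-span of a family of REAL numbers, read in `ℂ`, consists of numbers with zero imaginary
part; in particular it misses `πi`. [folklore] -/
private theorem pi_mul_I_not_mem_span {κ : Type*} (f : κ → ℝ) :
    (Real.pi : ℂ) * I ∉ Submodule.span ℚ (Set.range fun k => ((f k : ℝ) : ℂ)) := by
  intro h
  have key : ∀ z ∈ Submodule.span ℚ (Set.range fun k => ((f k : ℝ) : ℂ)), z.im = 0 := by
    intro z hz
    induction hz using Submodule.span_induction with
    | mem x hx =>
        obtain ⟨k, rfl⟩ := hx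
        exact Complex.ofReal_im _
    | zero => simp
    | add x y _ _ hx hy => rw [Complex.add_im, hx, hy, add_zero]
    | smul q x _ hx => rw [Rat.smul_def, Complex.mul_im, hx]; simp
  have hπ := key _ h
  simp only [Complex.mul_im, Complex.ofReal_re, Complex.I_im, mul_one, Complex.ofReal_im,
    Complex.I_re, mul_zero, add_zero] at hπ
  exact Real.pi_ne_zero hπ

/-- `e^{πi} = −1` is algebraic. [folklore] -/
private theorem isAlgebraic_cexp_pi_mul_I : IsAlgebraic ℚ (cexp ((Real.pi : ℂ) * I)) := by
  rw [Complex.exp_pi_mul_I]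
  exact isAlgebraic_one.neg

/-- **Murty–Saradha, Lemma 10 (coefficient form).** Let `αᵢ > 0` (`i` in a finite index type) be
real algebraic numbers and `β₀, c₀, cᵢ ∈ ℂ` algebraic with
`β₀ + c₀·(πi) + Σᵢ cᵢ log αᵢ = 0`. Then `β₀ = 0` and `c₀ = 0`. (Proof as printed: a maximal
`ℚ`-linearly independent sub-family of the real logarithms, extended by `log(−1) = πi` — still
`ℚ`-independent since `πi` is purely imaginary and the span of the `log αᵢ` is real — to which
Baker's Theorem 2.1 in coefficient form applies.)
[cite: MurtySaradha2010, Lemma 10 (proof)] -/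
theorem baker_pi_coeff_eq_zero {ι : Type*} [Fintype ι] (a : ι → ℝ) (ha : ∀ i, 0 < a i)
    (halg : ∀ i, IsAlgebraic ℚ (a i)) {β₀ c₀ : ℂ} {c : ι → ℂ} (hβ₀ : IsAlgebraic ℚ β₀)
    (hc₀ : IsAlgebraic ℚ c₀) (hc : ∀ i, IsAlgebraic ℚ (c i))
    (h : β₀ + c₀ * ((Real.pi : ℂ) * I) + ∑ i, c i * ((Real.log (a i) : ℝ) : ℂ) = 0) :
    β₀ = 0 ∧ c₀ = 0 := by
  classical
  set l : ι → ℂ := fun i => ((Real.log (a i) : ℝ) : ℂ) with hl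
  -- a maximal `ℚ`-linearly independent sub-family of the real logarithms, as a finset `B`
  obtain ⟨b, -, -, hspan, hli⟩ := exists_linearIndepOn_extension (K := ℚ) (v := l)
    (linearIndepOn_empty ℚ l) (Set.empty_subset Set.univ)
  obtain ⟨B, rfl⟩ := (Set.toFinite b).exists_finset_coe
  -- rational coordinates of every `l i`
  have hcoord : ∀ i, ∃ r : ι → ℚ, l i = ∑ j ∈ B, (r j : ℂ) * l j := by
    intro i
    have hi : l i ∈ Submodule.span ℚ (l '' (B : Set ι)) := hspan ⟨i, Set.mem_univ _, rfl⟩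
    rw [Submodule.mem_span_image_finset_iff_exists_fun'] at hi
    obtain ⟨r, hr⟩ := hi
    refine ⟨r, ?_⟩
    rw [← hr]
    exact Finset.sum_congr rfl fun j _ => by rw [Rat.smul_def]
  choose r hr using hcoord
  -- the independent sub-family, indexed by the subtype of `B`
  have hliB : LinearIndependent ℚ fun x : B => l x :=
    hli.linearIndependent.comp (fun x : B => (⟨x.1, Finset.mem_coe.mpr x.2⟩ : (B : Set ι)))
      fun x y hxy => Subtype.ext (by simpa using congrArg Subtype.val hxy)
  -- … extended by `πi`
  set F : Option B → ℂ := fun o => o.elim ((Real.pi : ℂ) * I) fun x => l x with hF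
  have hFli : LinearIndependent ℚ F := by
    rw [linearIndependent_option]
    refine ⟨hliB, ?_⟩
    have e : (F ∘ ((↑) : B → Option B)) = fun x : B => ((Real.log (a x) : ℝ) : ℂ) := by
      funext x; rfl
    rw [e]
    exact pi_mul_I_not_mem_span fun x : B => Real.log (a x)
  have hFalg : ∀ o, IsAlgebraic ℚ (cexp (F o)) := by
    rintro (_ | x)
    · exact isAlgebraic_cexp_pi_mul_I
    · change IsAlgebraic ℚ (cexp ((Real.log (a x) : ℝ) : ℂ))
      rw [← Complex.ofReal_exp, Real.exp_log (ha x)]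
      exact (halg x).algebraMap
  -- the relation in the coordinates of the sub-family
  have hsum : ∑ i, c i * l i = ∑ x : B, (∑ i, c i * (r i x : ℂ)) * l x := by
    rw [Finset.sum_coe_sort B (fun j => (∑ i, c i * (r i j : ℂ)) * l j)]
    calc ∑ i, c i * l i = ∑ i, ∑ j ∈ B, c i * (r i j : ℂ) * l j := by
            refine Finset.sum_congr rfl fun i _ => ?_
            rw [hr i, Finset.mul_sum]
            exact Finset.sum_congr rfl fun j _ => by ring
      _ = ∑ j ∈ B, ∑ i, c i * (r i j : ℂ) * l j := Finset.sum_comm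
      _ = ∑ j ∈ B, (∑ i, c i * (r i j : ℂ)) * l j :=
            Finset.sum_congr rfl fun j _ => by rw [Finset.sum_mul]
  set β : Option B → ℂ := fun o => o.elim c₀ fun x => ∑ i, c i * (r i x : ℂ) with hβ
  have hβalg : ∀ o, IsAlgebraic ℚ (β o) := by
    rintro (_ | x)
    · exact hc₀
    · change IsAlgebraic ℚ (∑ i, c i * (r i x : ℂ))
      rw [← mem_algebraicClosure_iff]
      refine sum_mem fun i _ => mul_mem (mem_algebraicClosure_iff.2 (hc i)) ?_
      rw [mem_algebraicClosure_iff, ← eq_ratCast (algebraMap ℚ ℂ)]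
      exact isAlgebraic_algebraMap _
  have key : β₀ + ∑ o, β o * F o = 0 := by
    rw [Fintype.sum_option]
    change β₀ + (c₀ * ((Real.pi : ℂ) * I) + ∑ x : B, (∑ i, c i * (r i x : ℂ)) * l x) = 0
    rw [← hsum, ← add_assoc]
    exact h
  have hB := baker_coeff_eq_zero F hFalg hFli hβ₀ hβalg key
  exact ⟨hB.1, hB.2 none⟩

/-- `i` is algebraic (`i² = −1`). [folklore] -/
private theorem isAlgebraic_I' : IsAlgebraic ℚ I := by
  refine IsAlgebraic.of_pow two_pos ?_
  rw [Complex.I_sq]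
  exact isAlgebraic_one.neg

/-- **Murty–Saradha, Lemma 10 (as printed, over `ℂ`).** «Let `α₁, …, αₙ` be positive algebraic
numbers. If `c₀, c₁, …, cₙ` are algebraic numbers with `c₀ ≠ 0`, then `c₀π + Σᵢ cᵢ log αᵢ` is a
transcendental number and hence non-zero.» (Here `cᵢ ∈ ℂ` algebraic, `αᵢ ∈ ℝ`, `αᵢ > 0`,
algebraic, `log` the real logarithm.) [cite: MurtySaradha2010, Lemma 10] -/
theorem transcendental_pi_mul_add_sum_log {ι : Type*} [Fintype ι] (a : ι → ℝ) (ha : ∀ i, 0 < a i)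
    (halg : ∀ i, IsAlgebraic ℚ (a i)) {c₀ : ℂ} {c : ι → ℂ} (hc₀ : IsAlgebraic ℚ c₀) (hc₀0 : c₀ ≠ 0)
    (hc : ∀ i, IsAlgebraic ℚ (c i)) :
    Transcendental ℚ (c₀ * (Real.pi : ℂ) + ∑ i, c i * ((Real.log (a i) : ℝ) : ℂ)) := by
  intro hx
  -- `c₀π = (−i c₀)·(πi)`
  have h : -(c₀ * (Real.pi : ℂ) + ∑ i, c i * ((Real.log (a i) : ℝ) : ℂ)) + (-I * c₀) * ((Real.pi : ℂ) * I) +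
      ∑ i, c i * ((Real.log (a i) : ℝ) : ℂ) = 0 := by
    have hI : -I * c₀ * ((Real.pi : ℂ) * I) = c₀ * Real.pi := by
      rw [show -I * c₀ * ((Real.pi : ℂ) * I) = -(I * I) * (c₀ * Real.pi) by ring, Complex.I_mul_I]
      ring
    rw [hI]; ring
  have h0 := (baker_pi_coeff_eq_zero a ha halg hx.neg (isAlgebraic_I'.neg.mul hc₀) hc h).2
  exact hc₀0 (by simpa [Complex.I_ne_zero] using h0)

/-- **Murty–Saradha, Lemma 10 (real coefficients).** For positive real algebraic `αᵢ` and real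
algebraic `c₀ ≠ 0`, `cᵢ`, the real number `c₀π + Σᵢ cᵢ log αᵢ` is transcendental.
[cite: MurtySaradha2010, Lemma 10] -/
theorem transcendental_real_pi_mul_add_sum_log {ι : Type*} [Fintype ι] (a : ι → ℝ)
    (ha : ∀ i, 0 < a i) (halg : ∀ i, IsAlgebraic ℚ (a i)) {c₀ : ℝ} {c : ι → ℝ}
    (hc₀ : IsAlgebraic ℚ c₀) (hc₀0 : c₀ ≠ 0) (hc : ∀ i, IsAlgebraic ℚ (c i)) :
    Transcendental ℚ (c₀ * Real.pi + ∑ i, c i * Real.log (a i)) := by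
  have hC := transcendental_pi_mul_add_sum_log a ha halg (c₀ := (c₀ : ℂ)) (c := fun i => (c i : ℂ))
    hc₀.algebraMap (by exact_mod_cast hc₀0) fun i => (hc i).algebraMap
  rw [← transcendental_algebraMap_iff (R := ℚ) (A := ℂ) Complex.ofReal_injective]
  simpa using hC

/-- **Lemma 9, first clause, for positive real arguments** (Baker): if `Σᵢ cᵢ log αᵢ` is algebraic
(`αᵢ > 0` real algebraic, `cᵢ ∈ ℂ` algebraic), then it vanishes. The case `c₀ = 0` of
`baker_pi_coeff_eq_zero`. [cite: MurtySaradha2010, Lemma 9] -/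
theorem sum_log_eq_zero_of_isAlgebraic {ι : Type*} [Fintype ι] (a : ι → ℝ) (ha : ∀ i, 0 < a i)
    (halg : ∀ i, IsAlgebraic ℚ (a i)) {c : ι → ℂ} (hc : ∀ i, IsAlgebraic ℚ (c i))
    (hx : IsAlgebraic ℚ (∑ i, c i * ((Real.log (a i) : ℝ) : ℂ))) :
    ∑ i, c i * ((Real.log (a i) : ℝ) : ℂ) = 0 := by
  have h : -(∑ i, c i * ((Real.log (a i) : ℝ) : ℂ)) + 0 * ((Real.pi : ℂ) * I) +
      ∑ i, c i * ((Real.log (a i) : ℝ) : ℂ) = 0 := by ring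
  have h0 := (baker_pi_coeff_eq_zero a ha halg hx.neg isAlgebraic_zero hc h).1
  exact neg_eq_zero.1 h0

/-- **The logarithm of a positive algebraic number is algebraic only when it vanishes**
(Lindemann; the one-term case of Lemma 9): `x > 0` algebraic with `log x` algebraic forces
`x = 1`. [cite: MurtySaradha2010, Lemma 9 (n = 1)] -/
theorem eq_one_of_isAlgebraic_log {x : ℝ} (hx : 0 < x) (halg : IsAlgebraic ℚ x)
    (hlog : IsAlgebraic ℚ (Real.log x)) : x = 1 := by
  have hC : IsAlgebraic ℚ ((Real.log x : ℝ) : ℂ) := hlog.algebraMap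
  have hx' : IsAlgebraic ℚ (∑ _i : Unit, (1 : ℂ) * ((Real.log x : ℝ) : ℂ)) := by simpa using hC
  have h := sum_log_eq_zero_of_isAlgebraic (ι := Unit) (fun _ => x) (fun _ => hx) (fun _ => halg)
    (c := fun _ => 1) (fun _ => isAlgebraic_one) hx'
  have h0 : Real.log x = 0 := by exact_mod_cast (by simpa using h)
  rcases Real.log_eq_zero.1 h0 with h1 | h1 | h1
  · exact absurd h1 hx.ne'
  · exact h1
  · linarith

end Literature.NumberTheory.Transcendental
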